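import Summits.BirchSwinnertonDyer.Rank1Residual.X12.O11.RamifiedRelativeRubinFormulaLineZp
import Summits.BirchSwinnertonDyer.Rank1Residual.X11b.EmbeddingDatumPrime
import Summits.BirchSwinnertonDyer.Rank1Residual.X11b.BDPRouteLocalIndexTransport
import Summits.BirchSwinnertonDyer.Rank1Residual.Additive.PadicLogImage
import Summits.BirchSwinnertonDyer.Rank1Residual.Additive.PadicLogFormalGroup
import Literature.NumberTheory.EllipticCurves.DeShalit1987.KatzPAdicLFunction
import Literature.NumberTheory.GaloisRepresentations.CMTypeHeckeCharacter
import Literature.NumberTheory.GaloisRepresentations.HeckeCharacterRamificationProofs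
import Literature.NumberTheory.EllipticCurves.HeegnerPoints
import Literature.NumberTheory.EllipticCurves.HeegnerPointsImaginaryQuadraticProofs
import Literature.NumberTheory.EllipticCurves.ComplexMultiplicationDeuringGrossencharacter
import Literature.NumberTheory.EllipticCurves.ComplexMultiplicationTwistIsogenyProofs
import Literature.NumberTheory.EllipticCurves.HeckeGrossencharakterFunctionalEquation
import Literature.NumberTheory.EllipticCurves.ZpExtensionAnticyclotomicHoldsProofs
import Literature.NumberTheory.EllipticCurves.BSDSelmerParityDokchitserTowerProofs
import Literature.NumberTheory.EllipticCurves.StrictSelmerRankOne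
import Literature.NumberTheory.QuadraticFields.FundamentalDiscriminant
import Literature.NumberTheory.QuadraticFields.KroneckerSplitting
import Literature.FieldTheory.AlgClosed.PadicAlgClEquivComplex
import Literature.NumberTheory.Automorphic.ReciprocityGLnPatchingFamily
import HarnessLib

/-!
# Rubin frames EXIST at `2` for every rank-one twist `49a1^{(d)}`, `d ≢ 1 (mod 4)` — the assembly stub S1
# `stub_katzFrame_two` of the crux line `rubin_value_two` (crux stmt-BirchSwinnertonDyer-20368, child
# stmt-BirchSwinnertonDyer-27850 `PrintCf2.SplitBadTwoUpperHalfOfFacts`), PROVED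

Width seat -w3 g2 of cell `bsd-print-cf2` (Rubin/GL₁ road to the upper half 27850, planner ASSIGN rev 26). The
ideator line `Cruxes/SplitBadTwoRankOneOfFacts/Lines/rubin_value_two.lean` (bsd-idea-7, v4) cuts Rubin's split-prime
programme at `p = 2` for the class `49a1^{(d)}`, `d ≢ 1 (mod 4)`, into S0 (prints) · S1 (frames) · S2 (2-adic Rubin
value formula) · S3 (elliptic-unit control) · S4 (anchors). Critic idea-crit-10 (V#50): «S1 (frames) is seat-able by
ONE M prover now». This file proves S1 VERBATIM (name and signature), HYPOTHESIS-TAKING from GZK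
(`rank_eq_analyticRank_of_analyticRank_le_one`), de Shalit II Thm. 4.14 (`DeShalit1987.thmII414_exists_katzBranch`,
`p = 2` included) and Deuring (`Deuring_exists_heckeCharacter_of_maximalCM`), every other clause being a tree THEOREM:

* the CM field `K = ℚ(√−7)` (`Quadratic.exists_numberField_discr_eq` at `D = −7`), imaginary quadratic, and
  `IsCMFieldOfJ K W.j` (`j(W) = j(49a1) = −3375`, `√d_K ∈ 𝓞_K`);
* `2 = v v̄` SPLIT in `K` (`d_K = −7 ≡ 1 (mod 8)`, `Quadratic.ncard_primesOver_two_eq_two_iff`), the two primes and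
  the non-trivial automorphism `c` with `c • v = v̄` (`X11b.LocalIndexTransport.exists_conj_prime_of_splitsIn`);
* an embedding datum `ι : ℚ̄₂ ≃ ℂ` inducing `v` (Steinitz `PadicAlgCl.nonempty_ringEquiv_complex` + the conjugate
  trick `X11b.exists_datum_forall_mem_iff`);
* Deuring's Grössencharacter `ψ` (type `(1,0)`, `L(ψ,s) = L(W,s)`, conj-equivariant) from the named fact; the finite
  set `S` of its ramified places away from `2` (`HeckeCharacter.finite_ramifiedPlaces_holds`);
* THE anticyclotomic `ℤ₂`-extension `κ` of `K` with a topological generator `γ` (`ZpExtension.exists_isAnticyclotomic_holds`,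
  Kronecker–Weber and Leopoldt for imaginary quadratic fields being tree theorems; `exists_isTopGenerator`);
* the Katz–de Shalit branch `G ∈ 𝓞_{ℂ₂}⟦T⟧` through `λ = (ψ∘c)⁻¹` from the named fact: `λ` is ALGEBRAIC because
  conj-equivariance makes `ψ∘c` of infinity type `(0,1)` (`hasInfinityType_galConj_of_isHeckeConjEquivariant`,
  new here), and `λ` is unramified outside `S ∪ {v, v̄}` because `ψ∘c` has the same ramification as `ψ`
  (`IsHeckeConjEquivariant.isUnramifiedAt_galConj_iff'`);
* the Mordell–Weil generator `P` (`exists_generator_of_mordellWeilRank_eq_one`; rank one = GZK applied to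
  `r_an = 1`), and the formal-group clause: `c₀ = [E(ℚ₂) : E⁽²⁾(ℚ₂)]`, `[c₀]P ∈ E₁(ℚ₂)`, and
  `‖log_Ŵ([c₀]P)/c₀‖ = 2^{−ℓ}` with `log ≠ 0` since `P` is non-torsion (`Additive.LocalLog.padicLog_eq_zero_iff`).

Nothing about BSD is asserted; the theorem is conditional on the three named facts exactly as the stub is typed.
BSD is not proved by any of this; no summit statement is proved by this seat.
-/

set_option autoImplicit false
-- D-0017 layout: summit = sub-problem, so `Summit.BirchSwinnertonDyer.BirchSwinnertonDyer.…` repeats a path component.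
set_option linter.dupNamespace false

noncomputable section

open scoped Classical
open ComplexConjugate
open NumberField IsDedekindDomain Field WeierstrassCurve
open Literature.NumberTheory.GaloisRepresentations Literature.NumberTheory.EllipticCurves
open Literature.NumberTheory.EllipticCurves.Rank1Residual
open Literature.NumberTheory.EllipticCurves.DeShalit1987

namespace Summit.BirchSwinnertonDyer.BirchSwinnertonDyer.Theorems.PrintCf2.RubinValueTwo

/-! ## §1 Conj-equivariant Hecke characters: the conjugate has the swapped infinity type -/

section ConjEquivariant

variable {K : Type} [Field K] [NumberField K]

/-- `conj ∘ A_{p,q} = A_{q,p}`: complex conjugation swaps the two exponents of the archimedean factor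
(`A_{p,q}(x) = ∏_w ι_w(x_w)^{-p_w} \overline{ι_w(x_w)}^{-q_w}`). [folklore] -/
theorem conj_archFactor (p q : InfinitePlace K → ℤ) (x : (InfiniteAdeleRing K)ˣ) :
    conj (HeckeCharacter.archFactor p q x) = HeckeCharacter.archFactor q p x := by
  rw [HeckeCharacter.archFactor_apply, HeckeCharacter.archFactor_apply, map_prod]
  refine Finset.prod_congr rfl fun w _ => ?_
  rw [map_mul, map_zpow₀, map_zpow₀, Complex.conj_conj, mul_comm]

/-- **A conj-equivariant Hecke character of infinity type `(p, q)` has a conjugate `ψ ∘ c` of infinity type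
`(q, p)`**: `(ψ∘c)(x) = \overline{ψ(x)}` on all ideles, in particular on the infinite ones, and
`\overline{A_{p,q}(x)} = A_{q,p}(x)`. For Deuring's `ψ_E` (type `(1,0)`) this makes `ψ_E ∘ c` of type `(0,1)` and
`(ψ_E ∘ c)⁻¹` of type `(0,−1)` — Rubin's `ψ*⁻¹`-branch variable. [cite: SerreAbelianLadic1968, Ch. II §2.4] -/
theorem hasInfinityType_galConj_of_isHeckeConjEquivariant {c : K ≃ₐ[ℚ] K} {ψ : HeckeCharacter K}
    (h : IsHeckeConjEquivariant c ψ) {p q : InfinitePlace K → ℤ} (hψ : ψ.HasInfinityType p q) :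
    (HeckeCharacter.galConj c ψ).HasInfinityType q p := by
  obtain ⟨U, hU, hx⟩ := hψ
  refine ⟨U, hU, fun x hxU => ?_⟩
  rw [h, hx x hxU, conj_archFactor]

/-- Hence `(ψ ∘ c)⁻¹` is ALGEBRAIC for a conj-equivariant algebraic `ψ` (the hypothesis of de Shalit II.4.14 on
the branch character). [cite: deShalit1987, II Thm. 4.14 (p. 71)] -/
theorem isAlgebraic_inv_galConj_of_isHeckeConjEquivariant {c : K ≃ₐ[ℚ] K} {ψ : HeckeCharacter K}
    (h : IsHeckeConjEquivariant c ψ) {p q : InfinitePlace K → ℤ} (hψ : ψ.HasInfinityType p q) :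
    (HeckeCharacter.galConj c ψ)⁻¹.IsAlgebraic :=
  ⟨_, _, (hasInfinityType_galConj_of_isHeckeConjEquivariant h hψ).inv⟩

end ConjEquivariant

/-! ## §2 The formal-group clause at `2`: `[c₀]P ∈ E₁(ℚ₂)` and `‖log_Ŵ([c₀]P)/c₀‖ = 2^{−ℓ}` -/

/-- **The 2-adic logarithm of a non-torsion rational point, read in the stub's currency.** For `W/ℚ` globally
minimal and `P ∈ W(ℚ)` of infinite order: with `c₀ = [E(ℚ₂) : E⁽²⁾(ℚ₂)]` (finite, Silverman AEC VII.6.3),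
`[c₀]P ∈ E⁽²⁾(ℚ₂) ⊆ E₁(ℚ₂)` and `log_Ŵ([c₀]P)/c₀ = log_ω(P) ≠ 0` (the `ℤ₂`-linear logarithm
`Additive.LocalLog.padicLog` vanishes exactly at torsion, `padicLog_eq_zero_iff`; `E(ℚ) → E(ℚ₂)` is injective),
so its norm is `2^{−ℓ}`, `ℓ = ord₂`. [cite: SilvermanAEC2009, IV.6.4, VII.2.2 and VII.6.3] -/
theorem exists_index_padicLog_two (W : WeierstrassCurve ℚ) [W.IsElliptic] [W.IsGloballyMinimal]
    {P : W.toAffine.Point} (hP : ¬ IsOfFinAddOrder P) :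
    ∃ (c₀ : ℕ) (ℓ : ℤ), c₀ ≠ 0 ∧ (W.baseChange ℚ_[2]).IsInReductionKernel (c₀ • W.toPadicPoint 2 P) ∧
      ‖(W.baseChange ℚ_[2]).padicLogPoint (c₀ • W.toPadicPoint 2 P) / (c₀ : ℚ_[2])‖ = (2 : ℝ) ^ (-ℓ) := by
  set X := W.baseChange ℚ_[2] with hX
  haveI := X.finiteIndex_formalFiltration 2
  set N : ℕ := (X.formalFiltration 2).index with hN
  have hN0 : N ≠ 0 := AddSubgroup.FiniteIndex.index_ne_zero
  have hmem : N • W.toPadicPoint 2 P ∈ X.formalFiltration 2 := (X.formalFiltration 2).nsmul_index_mem _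
  have hx : X.padicLogPoint (N • W.toPadicPoint 2 P) / (N : ℚ_[2]) =
      Summit.BirchSwinnertonDyer.Rank1Residual.Additive.LocalLog.padicLog X (W.toPadicPoint 2 P) :=
    (Summit.BirchSwinnertonDyer.Rank1Residual.Additive.LocalLog.padicLog_eq_padicLogPoint_nsmul_div X _).symm
  have hinj : Function.Injective (W.toPadicPoint 2) :=
    Affine.Point.map_injective (W' := W) (Algebra.ofId ℚ ℚ_[2])
  have hx0 : Summit.BirchSwinnertonDyer.Rank1Residual.Additive.LocalLog.padicLog X (W.toPadicPoint 2 P) ≠ 0 := by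
    rw [Ne, Summit.BirchSwinnertonDyer.Rank1Residual.Additive.LocalLog.padicLog_eq_zero_iff]
    exact fun h => hP (hinj.isOfFinAddOrder_iff.mp h)
  refine ⟨N, (Summit.BirchSwinnertonDyer.Rank1Residual.Additive.LocalLog.padicLog X (W.toPadicPoint 2 P)).valuation,
    hN0, hmem.1, ?_⟩
  rw [hx, Padic.norm_eq_zpow_neg_valuation hx0]
  norm_num

/-! ## §3 S1 of line `rubin_value_two`: Rubin frames exist at `2` (VERBATIM signature) -/

/-- **S1 — RUBIN FRAMES EXIST AT 2 for every rank-one twist `49a1^{(d)}`, `d ≢ 1 (mod 4)`** (stub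
`stub_katzFrame_two` of `Cruxes/SplitBadTwoRankOneOfFacts/Lines/rubin_value_two.lean`, VERBATIM, hypothesis-taking
from GZK, de Shalit II Thm. 4.14 and Deuring): the CM field `K` (imaginary quadratic), the two primes `v ≠ v̄` above
`2`, embedding data `ι` inducing `v`, a non-trivial automorphism `c`, the Grössencharacter `ψ` of `W` (type `(1,0)`,
`L(ψ,s) = L(W,s)`), the finite set `S` of the ramified places of `ψ` away from `2`, THE anticyclotomic `ℤ₂`-extension
`κ` with a topological generator `γ`, de Shalit period data `(Ω, δ, Ω₂)` and a branch `G ∈ 𝒪_{ℂ₂}⟦T⟧` with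
`IsKatzBranch ι v v̄ S κ γ (ψ∘c)⁻¹ Ω δ Ω₂ G`, a generator `P` of `W(ℚ)` modulo torsion, a multiplier `c₀ ≠ 0` with
`[c₀]P ∈ Ŵ(2ℤ₂)` and the exact norm `2^{−ℓ}` of `log_Ŵ([c₀]P)/c₀`. PROVED: every clause is a tree theorem (module
docstring) once the three named facts are granted. [cite: deShalit1987, II Thm. 4.14 (p. 71)]
[cite: Rubin1992, §9 (the character ψ* outside the range)] [cite: SilvermanATAEC1994, Ch. II Thm. 9.2 and Thm. 10.5 (Deuring)] -/
theorem stub_katzFrame_two :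
    rank_eq_analyticRank_of_analyticRank_le_one → DeShalit1987.thmII414_exists_katzBranch →
    Deuring_exists_heckeCharacter_of_maximalCM →
    ∀ (d : ℤ), d ≠ 0 → Squarefree d → d % 4 ≠ 1 →
    ∀ (W : WeierstrassCurve ℚ) [W.IsElliptic] [W.IsGloballyMinimal] (C : VariableChange ℚ),
      C • W = cm7.quadraticTwist (d : ℚ) → W.analyticRank = 1 →
    ∃ (K : Type) (_ : Field K) (_ : NumberField K) (v vbar : HeightOneSpectrum (𝓞 K))
      (ι : PadicAlgCl 2 ≃+* ℂ) (c : K ≃ₐ[ℚ] K) (ψ : HeckeCharacter K) (S : Finset (HeightOneSpectrum (𝓞 K)))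
      (κ : ZpExtension K 2) (γ : absoluteGaloisGroup K) (Ω δ : ℂ) (Ωp : (unrIntegers 2)ˣ)
      (G : PowerSeries (PadicComplexInt 2)) (P : W.toAffine.Point) (c₀ : ℕ) (ℓ : ℤ),
      IsImaginaryQuadratic K ∧
      ((2 : ℕ) : 𝓞 K) ∈ v.asIdeal ∧ ((2 : ℕ) : 𝓞 K) ∈ vbar.asIdeal ∧ vbar ≠ v ∧
      (∀ (w : InfinitePlace K) (k : 𝓞 K), k ∈ v.asIdeal ↔ ‖ι.symm (w.embedding (k : K))‖ < 1) ∧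
      c ≠ 1 ∧
      ψ.HasInfinityType (fun _ ↦ 1) (fun _ ↦ 0) ∧
      (∀ s : ℂ, 3 / 2 < s.re → heckeLFunction ψ s = W.LSeries s) ∧
      (∀ w : HeightOneSpectrum (𝓞 K), w ∈ S ↔ (¬ ψ.IsUnramifiedAt w ∧ w ≠ v ∧ w ≠ vbar)) ∧
      κ.IsAnticyclotomic ∧ κ.IsTopGenerator γ ∧
      Ω ≠ 0 ∧ (δ ^ 2 = (NumberField.discr K : ℂ) ∨ δ ^ 2 = -(NumberField.discr K : ℂ)) ∧
      IsKatzBranch ι v vbar S κ γ (HeckeCharacter.galConj c ψ)⁻¹ Ω δ ((Ωp : unrIntegers 2) : ℂ_[2]) G ∧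
      ¬ IsOfFinAddOrder P ∧
      (∀ R : W.toAffine.Point, ∃ (k : ℤ) (T : W.toAffine.Point), IsOfFinAddOrder T ∧ R = k • P + T) ∧
      c₀ ≠ 0 ∧ (W.baseChange ℚ_[2]).IsInReductionKernel (c₀ • W.toPadicPoint 2 P) ∧
      ‖(W.baseChange ℚ_[2]).padicLogPoint (c₀ • W.toPadicPoint 2 P) / (c₀ : ℚ_[2])‖ = (2 : ℝ) ^ (-ℓ) := by
  intro hGZK hdS hDeu d hd0 _hsq _hd4 W _ _ C hCW hr
  -- `j(W) = j(49a1) = −3375 ∈ maximalCMJInvariants`, `d_K = −7`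
  have hdQ : (d : ℚ) ≠ 0 := by exact_mod_cast hd0
  haveI := cm7.isElliptic_quadraticTwist hdQ
  have hWj : W.j = -3375 := by
    have hW' : C⁻¹ • cm7.quadraticTwist (d : ℚ) = W := by rw [← hCW, inv_smul_smul]
    subst hW'
    rw [variableChange_j, cm7.j_quadraticTwist hdQ, j_cm7]
  have hjm : W.j ∈ maximalCMJInvariants := by
    rw [hWj]; simp [maximalCMJInvariants]
  have hcm : cmFieldDiscr W.j = -7 := by rw [hWj]; norm_num [cmFieldDiscr]
  -- the CM field `K = ℚ(√−7)`
  obtain ⟨K, _, _, h2, hdK⟩ :=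
    Literature.NumberTheory.QuadraticFields.Quadratic.exists_numberField_discr_eq (D := -7)
      (Or.inl ⟨by norm_num, by
        rw [← Int.squarefree_natAbs]
        exact (Nat.prime_iff.mp (by norm_num : Nat.Prime 7)).squarefree, by norm_num⟩)
  have hK : IsImaginaryQuadratic K :=
    isImaginaryQuadratic_iff_discr_neg.mpr ⟨h2, by rw [hdK]; norm_num⟩
  have hKj : IsCMFieldOfJ K W.j := by
    obtain ⟨-, -, θ, -, hθ⟩ :=
      Literature.NumberTheory.QuadraticFields.Quadratic.exists_sq_eq_discr (K := K) h2
    refine ⟨h2, (θ : K), ?_⟩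
    have h := congrArg (algebraMap (𝓞 K) K) hθ
    rw [hdK, map_pow, map_intCast] at h
    rw [hcm]
    exact h
  -- `2 = v v̄` splits in `K`; the two primes and the automorphism interchanging them
  have hs : Summit.BirchSwinnertonDyer.Rank1Residual.X11b.SplitsIn K 2 := by
    unfold Summit.BirchSwinnertonDyer.Rank1Residual.X11b.SplitsIn
    rw [Nat.cast_ofNat, Literature.NumberTheory.QuadraticFields.Quadratic.ncard_primesOver_two_eq_two_iff h2, hdK]
    decide
  obtain ⟨v, hv⟩ :=
    Literature.NumberTheory.Automorphic.PatchingFamily.exists_heightOneSpectrum_natCast_mem K Nat.prime_two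
  obtain ⟨c, vbar, hcv, hne, hvbar, -⟩ :=
    Summit.BirchSwinnertonDyer.Rank1Residual.X11b.LocalIndexTransport.exists_conj_prime_of_splitsIn K 2 h2 hs hv
  have hc : c ≠ 1 := by
    rintro rfl
    rw [one_smul] at hcv
    exact hne hcv.symm
  -- an embedding datum inducing `v`
  obtain ⟨ι₀⟩ := PadicAlgCl.nonempty_ringEquiv_complex 2
  obtain ⟨ι, -, hι⟩ := Summit.BirchSwinnertonDyer.Rank1Residual.X11b.exists_datum_forall_mem_iff 2 ι₀ hK hv
  -- Deuring's Grössencharacter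
  obtain ⟨ψ, hψinf, hψconj, _hψunr, -, hψL⟩ := hDeu W hjm K hKj c hc
  -- the ramified places of `ψ` away from `2`
  have hfin : {w : HeightOneSpectrum (𝓞 K) | ¬ ψ.IsUnramifiedAt w ∧ w ≠ v ∧ w ≠ vbar}.Finite := by
    have h : ψ.ramifiedPlaces.Finite := HeckeCharacter.finite_ramifiedPlaces_holds ψ
    exact h.subset fun w hw => hw.1
  obtain ⟨S, hS⟩ : ∃ S : Finset (HeightOneSpectrum (𝓞 K)),
      ∀ w : HeightOneSpectrum (𝓞 K), w ∈ S ↔ (¬ ψ.IsUnramifiedAt w ∧ w ≠ v ∧ w ≠ vbar) :=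
    ⟨hfin.toFinset, fun w => by rw [Set.Finite.mem_toFinset]; rfl⟩
  have hvS : v ∉ S := fun h => ((hS v).mp h).2.1 rfl
  have hvbarS : vbar ∉ S := fun h => ((hS vbar).mp h).2.2 rfl
  -- THE anticyclotomic `ℤ₂`-extension and a topological generator
  obtain ⟨κ, hκ⟩ := ZpExtension.exists_isAnticyclotomic_holds (K := K) (p := 2) h2
    (fun w => hK.2.isComplex w)
  obtain ⟨γ, hγ⟩ := κ.exists_isTopGenerator
  -- de Shalit's periods and the branch through `λ = (ψ∘c)⁻¹`
  obtain ⟨Ω, δ, Ωp, hΩ, hδ, hbranch⟩ := hdS 2 K hK ι v vbar hv hvbar hne hι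
  have hlamAlg : (HeckeCharacter.galConj c ψ)⁻¹.IsAlgebraic :=
    isAlgebraic_inv_galConj_of_isHeckeConjEquivariant hψconj hψinf
  have hlamUnr : ∀ w : HeightOneSpectrum (𝓞 K), w ∉ S → w ≠ v → w ≠ vbar →
      (HeckeCharacter.galConj c ψ)⁻¹.IsUnramifiedAt w := by
    intro w hwS hwv hwvbar
    have hψw : ψ.IsUnramifiedAt w := by
      by_contra h
      exact hwS ((hS w).mpr ⟨h, hwv, hwvbar⟩)
    exact ((hψconj.isUnramifiedAt_galConj_iff' w).mpr hψw).inv'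
  obtain ⟨G, hG⟩ := hbranch S hvS hvbarS _ hlamAlg hlamUnr κ γ hγ
  -- the Mordell–Weil generator (rank one from GZK) and the formal-group clause
  have hrank : W.mordellWeilRank = 1 := by rw [(hGZK W hr.le).1, hr]
  obtain ⟨P, hP, hgen⟩ := exists_generator_of_mordellWeilRank_eq_one W hrank
  -- (the Mordell–Weil lemma is stated under the classical `DecidableEq`; transport along `Subsingleton`)
  have hP' : ¬ IsOfFinAddOrder P := by convert hP
  have hgen' : ∀ R : W.toAffine.Point, ∃ (k : ℤ) (T : W.toAffine.Point), IsOfFinAddOrder T ∧ R = k • P + T := by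
    intro R
    obtain ⟨a, t, ht, hR⟩ := hgen R
    exact ⟨a, t, by convert ht, by convert hR⟩
  obtain ⟨c₀, ℓ, hc₀, hker, hnorm⟩ := exists_index_padicLog_two W hP'
  exact ⟨K, inferInstance, inferInstance, v, vbar, ι, c, ψ, S, κ, γ, Ω, δ, Ωp, G, P, c₀, ℓ, hK, hv, hvbar, hne,
    hι, hc, hψinf, hψL, hS, hκ, hγ, hΩ, hδ, hG, hP', hgen', hc₀, hker, hnorm⟩

end Summit.BirchSwinnertonDyer.BirchSwinnertonDyer.Theorems.PrintCf2.RubinValueTwo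

end
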